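import Summits.QuantumFields.YangMills.Theorems.TubeZeroFreeChannel.Negative.TubeZeroFreeChannelFalseOfFluxVacuaTwoRate

/-!
# `TubeZeroFreeChannel` is false under flux dominance loss near the axis (H″)

Negative lemma for the crux `TubeZeroFreeChannel` (stmt-QuantumFields-18841).  H″ =
`FluxDominanceLossNearAxis` is the weakest typed residual hypothesis of the flux-vacua/Harnack-pinch
refutation programme: per cross-section `L` (cofinally), on a disc `B(β, R_L)` of ANY radius
`R_L ≤ δ` (shrinking with `L` allowed), a dominated `(k+2)`-level exponential-sum structure of the
tube partition functions with the vacuum strictly top at `β` and ONE point where a flux level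
reaches the vacuum in modulus.
* `tubeZeroFreeChannel_false_of_fluxDominanceLossNearAxis : H″ → ¬ TubeZeroFreeChannel` (stub A
  `stub_dominance_of_zeroFree` + maximum modulus; no Harnack);
* `fluxDominanceLossNearAxis_of_fluxVacuaTwoRate : FluxVacuaTwoRate → H″` (Harnack two-rate pinch),
  so the landed `tubeZeroFreeChannel_false_of_fluxVacuaTwoRate` (p151721) factors through H″.
H″ is open-problem grade (it needs `L`-uniform-enough complex spectral control of the `SO(3)`
transfer matrix at weak coupling plus 't Hooft light flux); it enters as a hypothesis, never as a
citation.  Authored by planner-cruxplan-stmt-QuantumFields-18841-flux-vacua-harnack-p-0 as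
`Cruxes/TubeZeroFreeChannel/FluxPinchPlanSketch.lean`; landed by the line lead
prover-line-stmt-QuantumFields-18841-a2-0 (crux protocol, MODE LINE), 2026-08-17.
-/

set_option autoImplicit false

noncomputable section

namespace Summit.QuantumFields.YangMills.Theorems.TubeZeroFreeChannel.Negative

open scoped BigOperators Topology
open MeasureTheory Filter Metric
open Literature.MathematicalPhysics.QuantumFieldTheory (LatticeRep IsCompactSimpleLieGroup boxSystem)
open Summit.QuantumFields.YangMills.Theses.ComplexCouplingChannel (TubeZeroFreeChannel)

/-! ## The hypothesis H″ -/

/-- **H″ — flux dominance loss near the axis (shrinking discs allowed).**  For SOME admissible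
`(G, r)`, cofinally in `β`, for every `δ > 0` and cofinally in the cross-section `L`: a radius
`0 < R ≤ δ` (depending on `L`), `k + 2` holomorphic zero-free levels `lam j` on `ball β R` with
envelope `Λ`, pairwise non-proportional moduli, dominating the tube partition functions
`(boxSystem r.ρ ![L,L,L,t]).partZ univ` for all large `t` up to `C (θΛ)^t`, `θ < 1`, the vacuum
`lam 0` strictly top at `β` — and a flux level `j₀ ≠ 0` reaching the vacuum in modulus at ONE
point `z₀` of the disc (the first vacuum/flux equimodularity height `y₀(L; β) → 0`).  Weaker than
`FluxVacuaTwoRate` (`fluxDominanceLossNearAxis_of_fluxVacuaTwoRate`); still open-problem grade at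
weak coupling (see the module docstring); it enters as a hypothesis, never as a citation. -/
def FluxDominanceLossNearAxis : Prop :=
  ∃ (G : Type) (_ : Group G) (_ : TopologicalSpace G) (_ : IsTopologicalGroup G)
    (_ : CompactSpace G) (_ : MeasurableSpace G) (_ : BorelSpace G),
    IsCompactSimpleLieGroup G ∧ ∃ r : LatticeRep G, ∀ b : ℝ, ∃ β : ℝ, b ≤ β ∧
      ∀ δ : ℝ, 0 < δ → ∀ L₁ : ℕ, ∃ L : ℕ, L₁ ≤ L ∧
        ∃ (R : ℝ) (k : ℕ) (n : Fin (k + 2) → ℕ) (lam : Fin (k + 2) → ℂ → ℂ) (Λ : ℂ → ℝ) (C θ : ℝ),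
          0 < R ∧ R ≤ δ ∧ (∀ j, 0 < n j) ∧ 0 ≤ C ∧ 0 ≤ θ ∧ θ < 1 ∧
          (∀ j, DifferentiableOn ℂ (lam j) (ball (β : ℂ) R)) ∧
          (∀ j, ∀ z ∈ ball (β : ℂ) R, lam j z ≠ 0 ∧ ‖lam j z‖ ≤ Λ z) ∧
          (∀ z ∈ ball (β : ℂ) R, ∃ j, ‖lam j z‖ = Λ z) ∧
          (∀ i j, i ≠ j → ¬ ∃ a : ℝ, ∀ z ∈ ball (β : ℂ) R, ‖lam i z‖ = a * ‖lam j z‖) ∧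
          (∃ t₁ : ℕ, ∀ z ∈ ball (β : ℂ) R, ∀ t : ℕ, t₁ ≤ t →
            ‖(boxSystem r.ρ (![L, L, L, t] : Fin 4 → ℕ)).partZ Finset.univ z
              - ∑ j, (n j : ℂ) * (lam j z) ^ t‖ ≤ C * (θ * Λ z) ^ t) ∧
          (∀ j, j ≠ 0 → ‖lam j (β : ℂ)‖ < ‖lam 0 (β : ℂ)‖) ∧
          ∃ j₀ : Fin (k + 2), j₀ ≠ 0 ∧ ∃ z₀ ∈ ball (β : ℂ) R, ‖lam 0 z₀‖ ≤ ‖lam j₀ z₀‖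

/-! ## The negative lemma -/

/-- **`TubeZeroFreeChannel` is false under H″** (stub A + maximum modulus; no Harnack).  If the crux
held at the `(G, r)` of H″, its open `D ∋ β` would contain a disc `B(β, δ)` uniformly zero-free for
`L ≥ L₁`, `t ≥ t₀(L)`; H″ at `(δ, L₁)` gives `L ≥ L₁` and levels on `B(β, R) ⊆ B(β, δ)`; stub A
(`stub_dominance_of_zeroFree`, fed with zero-freeness for `t ≥ max t₀ t₁` through the dictionary
`boxZ_eq_partZ`) makes the vacuum dominate every level on the disc; the touching point `z₀` and the
maximum modulus principle (`norm_eq_const_mul_of_dominated_touch`) make `lam j₀`, `lam 0`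
proportional in modulus — excluded. -/
theorem tubeZeroFreeChannel_false_of_fluxDominanceLossNearAxis (hP : FluxDominanceLossNearAxis) :
    ¬ TubeZeroFreeChannel := by
  intro hT
  rw [tubeZeroFreeChannel_iff_boxZ] at hT
  obtain ⟨G, _, _, _, _, _, _, hG, r, hr⟩ := hP
  obtain ⟨β₁, hβ₁⟩ := hT G hG r
  obtain ⟨β, hb, hβ⟩ := hr β₁
  obtain ⟨D, hDo, -, hβD, -, L₁, hL₁⟩ := hβ₁ β hb 1 one_pos
  obtain ⟨δ, hδ, hball⟩ := Metric.isOpen_iff.mp hDo _ hβD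
  obtain ⟨L, hLL₁, R, k, n, lam, Λ, C, θ, hR, hRδ, hn, hC, hθ, hθ1, hdlam, hlam, henv, hnd,
    ⟨t₁, hdom⟩, hstrict, j₀, hj₀, z₀, hz₀, hloss⟩ := hβ δ hδ L₁
  -- zero-freeness of the tubes of cross-section `L` on `ball β R ⊆ ball β δ ⊆ D`, `t ≥ max t₀ t₁`
  obtain ⟨t₀, ht₀⟩ := hL₁ L hLL₁
  set Z : ℕ → ℂ → ℂ := fun t z =>
    (boxSystem r.ρ (![L, L, L, t] : Fin 4 → ℕ)).partZ Finset.univ z with hZdef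
  have hzf : ∀ t, max t₀ t₁ ≤ t → ∀ z ∈ ball (β : ℂ) R, Z t z ≠ 0 := by
    intro t ht z hz
    have h := ht₀ t (le_trans (le_max_left _ _) ht) z (hball (ball_subset_ball hRδ hz))
    rwa [boxZ_eq_partZ] at h
  have hZd : ∀ t, max t₀ t₁ ≤ t → DifferentiableOn ℂ (Z t) (ball (β : ℂ) R) := by
    intro t _
    have h := (differentiable_boxZ r L t).differentiableOn (s := ball (β : ℂ) R)
    refine h.congr fun z _ => ?_
    simp only [hZdef, boxZ_eq_partZ]
  have hdom' : ∀ z ∈ ball (β : ℂ) R, ∀ t : ℕ, max t₀ t₁ ≤ t →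
      ‖Z t z - ∑ j, (n j : ℂ) * (lam j z) ^ t‖ ≤ C * (θ * Λ z) ^ t :=
    fun z hz t ht => hdom z hz t (le_trans (le_max_right _ _) ht)
  -- STUB A (landed): the vacuum dominates every level on the whole disc
  have hdomAll := stub_dominance_of_zeroFree Z (β : ℂ) R k lam n Λ C θ (max t₀ t₁) hR hn hC hθ hθ1
    hZd hdlam hlam henv hnd hdom' hstrict hzf
  -- maximum modulus: `λ_{j₀}` and `λ₀` are proportional in modulus — excluded
  obtain ⟨a, ha⟩ := norm_eq_const_mul_of_dominated_touch (hdlam 0) (hdlam j₀)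
    (fun z hz => (hlam 0 z hz).1) (fun z hz => hdomAll j₀ z hz) hz₀ hloss
  exact hnd j₀ 0 hj₀ ⟨a, ha⟩

/-! ## `FluxVacuaTwoRate` implies H″ (the landed negative lemma factors through H″) -/

/-- **H ⇒ H″**: the flux-vacua two-rate hypothesis `FluxVacuaTwoRate` implies the dominance-loss
form, by the Harnack two-rate pinch (`exists_re_nonpos_of_twoRate`): `Re g_L(z₀) ≤ 0` gives
`‖λ₀(z₀)‖ = ‖λ_{j₀}(z₀)‖ e^{Re g_L(z₀)} ≤ ‖λ_{j₀}(z₀)‖`.  So the landed negative lemma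
`tubeZeroFreeChannel_false_of_fluxVacuaTwoRate` factors through
`tubeZeroFreeChannel_false_of_fluxDominanceLossNearAxis`. -/
theorem fluxDominanceLossNearAxis_of_fluxVacuaTwoRate (hP : FluxVacuaTwoRate) :
    FluxDominanceLossNearAxis := by
  obtain ⟨G, i₁, i₂, i₃, i₄, i₅, i₆, hG, r, hr⟩ := hP
  refine ⟨G, i₁, i₂, i₃, i₄, i₅, i₆, hG, r, fun b => ?_⟩
  obtain ⟨β, hb, hβ⟩ := hr b
  refine ⟨β, hb, fun δ hδ L₁ => ?_⟩
  obtain ⟨R, x, k, n, j₀, lam, Λ, g, L₀, hR, hRδ, hx, hn, hj₀, hL, hrate⟩ := hβ δ hδ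
  have hd : ∀ᶠ L in atTop, DifferentiableOn ℂ (g L) (ball (β : ℂ) R) :=
    eventually_atTop.2 ⟨L₀, fun L hLL => (hL L hLL).2.2.2.2.2.2.1⟩
  have hpos : ∀ᶠ L in atTop, 0 < (g L β).re :=
    eventually_atTop.2 ⟨L₀, fun L hLL => (hL L hLL).2.2.2.2.2.2.2.1⟩
  have hfreq := exists_re_nonpos_of_twoRate hR hx hd hpos hrate
  obtain ⟨L, hLge, z₀, hz₀, hgz₀⟩ := (frequently_atTop.1 hfreq) (max L₀ L₁)
  have hLL₀ : L₀ ≤ L := le_trans (le_max_left _ _) hLge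
  have hLL₁ : L₁ ≤ L := le_trans (le_max_right _ _) hLge
  obtain ⟨hdlam, hlam, henv, hnd, ⟨C, θ, hC, hθ, hθ1, hdom⟩, hstrict, -, -, hfac⟩ := hL L hLL₀
  -- at `z₀` the vacuum level is no longer strictly dominant
  have hloss : ‖lam L 0 z₀‖ ≤ ‖lam L j₀ z₀‖ := by
    rw [hfac z₀ hz₀, norm_mul, Complex.norm_exp]
    have h1 : Real.exp (g L z₀).re ≤ 1 := by
      rw [← Real.exp_zero]; exact Real.exp_le_exp.mpr hgz₀
    calc ‖lam L j₀ z₀‖ * Real.exp (g L z₀).re ≤ ‖lam L j₀ z₀‖ * 1 :=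
          mul_le_mul_of_nonneg_left h1 (norm_nonneg _)
      _ = ‖lam L j₀ z₀‖ := mul_one _
  exact ⟨L, hLL₁, R, k, n, lam L, Λ L, C, θ, hR, hRδ, hn, hC, hθ, hθ1, hdlam, hlam, henv, hnd,
    ⟨1, hdom⟩, hstrict, j₀, hj₀, z₀, hz₀, hloss⟩

end Summit.QuantumFields.YangMills.Theorems.TubeZeroFreeChannel.Negative

end
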